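import Summits.CriticalPhenomena.PercolationContinuityZ3.Theorems.Transplant.AutCocompactFinitelyGeneratedDichotomy
import Literature.Probability.Percolation.IsoperimetricGrowth
import Literature.GroupTheory.Nilpotent.AbelianGrowthBound
import HarnessLib

/-!
# Benjamini–Schramm QUESTION 2 ('`Dim(G) > 1 ⇒ p_c < 1`') on the lane's C2 action class: every finite-orbit action of a virtually nilpotent group
# on a connected locally finite graph with a `d`-dimensional isoperimetric inequality, `d > 1`, has `p_c < 1` (and `θ(p_c) = 0`)

builds on p205010 (kernel theorem, internal audit signed; external expert review pending) — through «AutCocompactFinitelyGenerated» p595968 for the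
`θ(p_c) = 0` clause only.  Lane `prim-bschramm`, seat `prim-bschramm-stmt` gen 38 (stmt port pen; lead g25 GO #7795 + RULING F6 #7797 adopting the
refuter's located item L-p5g31-4 — the head theorem is FG-free).  Helper file (`--supports stmt-CriticalPhenomena-4575 --as helper`); PROOFS ONLY (def-free,
no `instance`, no notation).  NOT by-name: the OPEN print node `BenjaminiSchramm1996_question2` («StatementTransitiveGraphConjectures»; all connected locally
finite graphs with `Dim(G) > 1`) is NOT closed — MUST-NOT 'Question 2 closed'; its site form is untouched; STATEMENTS §5 counts unchanged; nothing about
`BenjaminiSchramm1996_conj4_endState`.  PRINT STATUS (located words item L-words-p5g31-2, refuter p5-g31, lead g25 #7804 / RULING #7809; this paragraph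
is the doc-only re-file of p599244, every declaration byte-identical): in print the answer to Question 2 is known for bounded-degree graphs with `Dim > 4`
(Duminil-Copin–Goswami–Raoufi–Severo–Yadin 2020, Thm. 1.1) and for ALL quasi-transitive graphs of superlinear growth (ibid., Thm. 1.2; Teixeira 2016 for
polynomial growth with a strong isoperimetric inequality) — a class which CONTAINS this file's class; so the `p_c < 1` half below is a kernel CERTIFICATION
of a printed fact by an elementary route (no Gaussian free field, no Trofimov; the group is given), and only the `θ(p_c) = 0` half is the lane's
(«AutCocompactFinitelyGenerated», V158 ADD 9).  Nothing here is typed from DGRSY 2020.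

THE ARGUMENT.  (Q2, `linearGrowth_of_cyclicModKer`) If ONE element `a` of the acting group generates, together with the kernel of the action, a
finite-index subgroup, the graph has LINEAR growth: in the faithful image `A₀ ≤ Perm W` the cyclic subgroup `⟨ā⟩` has finite index
(`index_zpowers_rangeRestrict`, «…Dichotomy»), hence finitely many orbits (gen-1 g6's `exists_reps_of_finiteIndex`), so gen-1 g6's cocompact growth
transfer `AutChart.exists_finset_ballVolume_le_card_mul` (no stabiliser hypothesis) bounds `|B_X(x, n)|` by `|reps| · |B_{Cay(⟨ā⟩; S)}(1, n)|` for a finite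
`S ⊆ ⟨ā⟩`, which the Literature's change of generators (`exists_ballVolume_mulCayley_le`) and abelian word-ball count
(`ballVolume_mulCayley_le_of_isMulCommutative`, one generator: `2 K n + 1`) make linear.  (Q1, Literature «IsoperimetricGrowth»
`not_linearGrowth_of_isoperimetricInequality`) a `d`-dimensional isoperimetric inequality with `d > 1` — the tree's `IsoperimetricInequality G d`
over the OUTER VERTEX boundary («UniquenessThreshold» :175–177; finite graphs never satisfy it) — excludes linear growth.  (Q3) Hence the dichotomy
«AutCocompactFinitelyGeneratedDichotomy» p596130 gives `p_c < 1` for finitely generated `A` (`question2_of_fg_virtuallyNilpotent_cocompact`), and the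
finite-generation binder is IDLE (L-p5g31-4): restrict to the finitely generated `H = closure S` of F1's `exists_finset_closure_smul_reps` with the same
representatives, exactly as «AutCocompactFinitelyGenerated» §4 — **`question2_of_virtuallyNilpotent_cocompact`**, literally Question 2's binder shape
`(∃ d, 1 < d ∧ IsoperimetricInequality X d) → criticalProb X x < 1` on every graph whose quasi-transitivity is witnessed by a virtually nilpotent group,
NOTHING else assumed; with «AutCocompactFinitelyGenerated»'s FG-free `conj4_of_virtuallyNilpotent_cocompact` also `θ_x(p_c) = 0`
(`question2_conj4_of_virtuallyNilpotent_cocompact`).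
[cite: BenjaminiSchramm1996, Question 2 (p. 74), §2 Conj. 1, Conj. 4] [cite: DuminilCopinGoswamiRaoufiSeveroYadin2020, Thm. 1.1, Thm. 1.2 (print status only — not typed)]
[cite: LyonsPeres2016, §6.1, §7.4 Cor. 7.19] [cite: Woess2000, Prop. 3.9, Lemma 3.13, §3.B p. 31] [cite: WolfGrowth1968, §3]
-/

noncomputable section

namespace Summit.CriticalPhenomena.PercolationContinuityZ3.Theorems.Transplant

namespace AutCyl

open SimpleGraph Literature.Barriers.CriticalPhenomena Literature.Probability.LatticeModels Literature.Probability.Percolation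
open scoped Classical

variable {W : Type} [DecidableEq W] {X : SimpleGraph W} {A : Type} [Group A] [MulAction A W] [X.LocallyFinite]

omit [DecidableEq W] in
/-- **One element of finite index modulo the kernel forces LINEAR growth**: if `zpowers a ⊔ ker (A → Perm W)` has finite index in the group acting
by automorphisms with finitely many orbits, then `|B_X(x, n)| ≤ C (n + 1)` for some `C` and all `n`.
[cite: Woess2000, Prop. 3.9, Lemma 3.13, §3.B p. 31] [cite: WolfGrowth1968, §3 (abelian word balls)] -/
theorem linearGrowth_of_cyclicModKer (hact : IsActionByAut X A) (reps : Finset W) (hcover : ∀ w : W, ∃ a : A, ∃ r ∈ reps, a • r = w)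
    (a : A) (ha : (Subgroup.zpowers a ⊔ (MulAction.toPermHom A W).ker).FiniteIndex) (x : W) :
    ∃ C : ℕ, ∀ n : ℕ, ballVolume X x n ≤ C * (n + 1) := by
  set c : (MulAction.toPermHom A W).range := (MulAction.toPermHom A W).rangeRestrict a with hcdef
  set H : Subgroup (MulAction.toPermHom A W).range := Subgroup.zpowers c with hH
  haveI : H.FiniteIndex := ⟨by rw [hH, hcdef, index_zpowers_rangeRestrict]; exact ha.index_ne_zero⟩
  obtain ⟨reps', hcover'⟩ := exists_reps_of_finiteIndex H reps (cover_range hcover)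
  obtain ⟨S, hS⟩ := AutChart.exists_finset_ballVolume_le_card_mul (isActionByAut_subgroup (isActionByAut_range hact) H) reps' hcover'
  -- compare with the single generator `g₀ = c` of the cyclic group `H`
  let g₀ : H := ⟨c, Subgroup.mem_zpowers c⟩
  have hgen : Subgroup.closure (↑({g₀} : Finset H) : Set H) = ⊤ := by
    rw [Finset.coe_singleton, eq_top_iff]
    rintro y -
    obtain ⟨k, hk⟩ := Subgroup.mem_zpowers_iff.1 y.2
    rw [Subgroup.mem_closure_singleton]
    exact ⟨k, Subtype.ext (by rw [Subgroup.coe_zpow]; exact hk)⟩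
  obtain ⟨K, hK⟩ := Literature.GroupTheory.Nilpotent.exists_ballVolume_mulCayley_le S {g₀} hgen
  refine ⟨reps'.card * (2 * K + 1), fun n => ?_⟩
  calc ballVolume X x n ≤ reps'.card * ballVolume (mulCayley (↑S : Set H)) 1 n := hS x n
    _ ≤ reps'.card * ballVolume (mulCayley (↑({g₀} : Finset H) : Set H)) 1 (K * n) := Nat.mul_le_mul_left _ (hK n)
    _ ≤ reps'.card * (2 * (K * n) + 1) ^ ({g₀} : Finset H).card :=
        Nat.mul_le_mul_left _ (Literature.GroupTheory.Nilpotent.ballVolume_mulCayley_le_of_isMulCommutative {g₀} (K * n))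
    _ = reps'.card * (2 * (K * n) + 1) := by rw [Finset.card_singleton, pow_one]
    _ ≤ reps'.card * (2 * K + 1) * (n + 1) := by
        rw [mul_assoc]
        exact Nat.mul_le_mul_left _ (by nlinarith [Nat.zero_le K, Nat.zero_le n])

/-- **QUESTION 2 on the C2 action class, finitely generated engine**: `A` finitely generated with a finite-index nilpotent subgroup acting by automorphisms
with finitely many orbits on a connected locally finite graph satisfying a `d`-dimensional isoperimetric inequality with `d > 1` ⟹ `p_c(x) < 1`
(the dichotomy p596130: otherwise one element acts with finite index modulo the kernel, the growth is linear, contradicting Literature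
`not_linearGrowth_of_isoperimetricInequality`). [cite: BenjaminiSchramm1996, Question 2 (p. 74), §2 Conj. 1] [cite: LyonsPeres2016, §6.1, §7.4 Cor. 7.19] -/
theorem question2_of_fg_virtuallyNilpotent_cocompact [Group.FG A] (hc : X.Connected) (hact : IsActionByAut X A) (reps : Finset W)
    (hcover : ∀ w : W, ∃ a : A, ∃ r ∈ reps, a • r = w) (N : Subgroup A) [N.FiniteIndex] [Group.IsNilpotent N]
    (hiso : ∃ d : ℝ, 1 < d ∧ IsoperimetricInequality X d) (x : W) : criticalProb X x < 1 := by
  refine (criticalProb_lt_one_iff_of_fg_virtuallyNilpotent hc hact reps hcover N x).2 ?_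
  rintro ⟨a, ha⟩
  obtain ⟨d, hd, hI⟩ := hiso
  obtain ⟨C, hC⟩ := linearGrowth_of_cyclicModKer hact reps hcover a ha x
  exact not_linearGrowth_of_isoperimetricInequality X hd hI x ⟨C, fun n => by exact_mod_cast hC n⟩

/-- **BENJAMINI–SCHRAMM QUESTION 2 ON THE C2 ACTION CLASS — NOTHING ELSE ASSUMED** (located item L-p5g31-4: the finite-generation binder is idle): every
connected locally finite graph carrying an action by automorphisms with finitely many orbits of a VIRTUALLY NILPOTENT group (kernel, torsion, stabilisers,
finite generation arbitrary) and satisfying a `d`-dimensional isoperimetric inequality with `d > 1` has `p_c(x) < 1` at every vertex — literally the binder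
shape of `BenjaminiSchramm1996_question2` on this class (the node itself, all connected locally finite graphs with `Dim(G) > 1`, stays OPEN).  Restriction
to the finitely generated `H = closure S` of F1's `exists_finset_closure_smul_reps` (same representatives; `N.subgroupOf H` finite index and nilpotent
via the tautological `MulEquiv`), then the engine. [cite: BenjaminiSchramm1996, Question 2 (p. 74)] [cite: Woess2000, Prop. 3.9] -/
theorem question2_of_virtuallyNilpotent_cocompact (hc : X.Connected) (hact : IsActionByAut X A) (reps : Finset W)
    (hcover : ∀ w : W, ∃ a : A, ∃ r ∈ reps, a • r = w) (N : Subgroup A) [N.FiniteIndex] [Group.IsNilpotent N]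
    (hiso : ∃ d : ℝ, 1 < d ∧ IsoperimetricInequality X d) (x : W) : criticalProb X x < 1 := by
  obtain ⟨S, hS⟩ := exists_finset_closure_smul_reps hact hc reps hcover
  set H : Subgroup A := Subgroup.closure (S : Set A) with hH
  have hcoverH : ∀ w : W, ∃ a : H, ∃ r ∈ reps, a • r = w := fun w => by
    obtain ⟨a, ha, r, hr, hw⟩ := hS w
    exact ⟨⟨a, ha⟩, r, hr, hw⟩
  let e : H.subgroupOf N ≃* N.subgroupOf H :=
    { toFun := fun y => ⟨⟨((y : N) : A), Subgroup.mem_subgroupOf.1 y.2⟩, Subgroup.mem_subgroupOf.2 (y : N).2⟩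
      invFun := fun z => ⟨⟨((z : H) : A), Subgroup.mem_subgroupOf.1 z.2⟩, Subgroup.mem_subgroupOf.2 (z : H).2⟩
      left_inv := fun y => rfl
      right_inv := fun z => rfl
      map_mul' := fun y z => rfl }
  haveI : Group.IsNilpotent (N.subgroupOf H) := Group.nilpotent_of_mulEquiv e
  exact question2_of_fg_virtuallyNilpotent_cocompact (A := H) hc (isActionByAut_subgroup hact H) reps hcoverH (N.subgroupOf H) hiso x

/-- **QUESTION 2 + CONJECTURE 4 on the class**: under the same hypotheses `p_c(x) < 1` AND `θ_x(p_c) = 0` («AutCocompactFinitelyGenerated»'s FG-free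
`conj4_of_virtuallyNilpotent_cocompact`). [cite: BenjaminiSchramm1996, Question 2 (p. 74), Conj. 4] -/
theorem question2_conj4_of_virtuallyNilpotent_cocompact (hc : X.Connected) (hact : IsActionByAut X A) (reps : Finset W)
    (hcover : ∀ w : W, ∃ a : A, ∃ r ∈ reps, a • r = w) (N : Subgroup A) [N.FiniteIndex] [Group.IsNilpotent N]
    (hiso : ∃ d : ℝ, 1 < d ∧ IsoperimetricInequality X d) (x : W) :
    criticalProb X x < 1 ∧ theta X x (criticalProbIOf X x) = 0 :=
  have hpc := question2_of_virtuallyNilpotent_cocompact hc hact reps hcover N hiso x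
  ⟨hpc, conj4_of_virtuallyNilpotent_cocompact hc hact reps hcover N x hpc⟩

end AutCyl

end Summit.CriticalPhenomena.PercolationContinuityZ3.Theorems.Transplant

end
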